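import Literature.NumberTheory.GaloisRepresentations.PicardLambdaAdicRep
import Literature.NumberTheory.GaloisRepresentations.AbsIntegersResidueField
import HarnessLib

/-!
# The valuation ring `ℤ̄_𝔓 ⊆ K̄` of a prime of the absolute integers, its residue map, and roots mod `𝔓`

Topic `Literature/NumberTheory/GaloisRepresentations` (continues `IntegralGaloisAction`, `AbsIntegersResidueField`,
`PicardLambdaAdicRep`).  Let `K` be a number field, `K̄ = AlgebraicClosure K`, `ℤ̄ = absIntegers (𝓞 K) K` the ring of
all algebraic integers of `K̄` and `𝔓` a maximal ideal of `ℤ̄` (residue field `κ(𝔓) = ℤ̄/𝔓`, an algebraic closure of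
the residue field of `𝔭 = 𝔓 ∩ 𝓞 K`, `absIntegers.isAlgClosed_quotient`).  This file provides the constant-field
side of the reduction theory of curves over `K` modulo `𝔓` (Deuring 1942: reduction along a place of the constant
field), in Mathlib's vocabulary:

* `absIntegersLocalization 𝔓` — the local ring `ℤ̄_𝔓 = {n/d : n, d ∈ ℤ̄, d ∉ 𝔓} ⊆ K̄` (a `Subring`);
  `mem_absIntegersLocalization_or_inv_mem` — **`ℤ̄_𝔓` is a valuation ring of `K̄`** (every `x ∈ K̄` lies in a number
  field `M = K(x)`, `𝔓 ∩ 𝓞 M` is a nonzero prime of the Dedekind domain `𝓞 M`, whose local ring is a discrete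
  valuation ring contained in `ℤ̄_𝔓`; Atiyah–Macdonald Thm. 9.3), packaged as the `ValuationSubring`
  `absIntegersValuationSubring 𝔓`; `exists_div_mem_absIntegersLocalization` — finitely many elements of `K̄` can be
  scaled by one of them into `ℤ̄_𝔓` ("primitive representatives");
* `absIntegersResidue 𝔓 : ℤ̄_𝔓 →+* ℤ̄/𝔓`, `n/d ↦ n̄/d̄` — the residue map (surjective, `absIntegersResidue_surjective`;
  kernel = non-units, `inv_mem_absIntegersLocalization_iff`; `absIntegersResidue_coe`: it extends `ℤ̄ → ℤ̄/𝔓`, so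
  in particular `CyclicCoverDeck.reduceMod` on roots of unity); `absIntegersResidue'` — its extension by `0` to `K̄`;
* equivariance for the decomposition group `D_𝔓 = Stab_{Γ_K}(𝔓)`: `smul_mem_absIntegersLocalization_iff`,
  **`absIntegersResidue_smul`** — `(τ x)‾ = τ̄ x̄` with `τ̄ = Ideal.Quotient.stabilizerHom 𝔓 𝔭 Γ_K τ`;
* **roots of reductions** (`roots_map_absIntegersResidue`, `rootMultiplicity_map_absIntegersResidue`): for
  `R ∈ ℤ̄_𝔓[X]` with `R mod 𝔓 ≠ 0`, the roots of `R mod 𝔓` in `ℤ̄/𝔓` are, with multiplicity, the reductions of the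
  `𝔓`-integral roots of `R` in `K̄` (factor `R = c ∏_{αᵢ ∈ ℤ̄_𝔓}(X - αᵢ) ∏_{αⱼ ∉ ℤ̄_𝔓}(1 - αⱼ⁻¹X)` over the
  algebraically closed `K̄`, using that `ℤ̄_𝔓` is a valuation ring; `c` is a `𝔓`-unit).

Everything is proved; the `def`s (`absIntegersLocalization`, `absIntegersValuationSubring`, `absIntegersResidueAux`,
`absIntegersResidue`, `absIntegersResidue'`) are genuine.  Used by the reduction of the superelliptic curves
`y^p = f(x)` modulo `𝔓` (`SuperellipticReduction`).

## References

* M. Deuring, *Reduktion algebraischer Funktionenkörper nach Primdivisoren des Konstantenkörpers*, Math. Z. 47 (1942)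
  643–654. [Deuring1942Reduktion]
* M. F. Atiyah, I. G. Macdonald, *Introduction to Commutative Algebra* (1969), Prop. 5.18, Thm. 9.3 (local rings of a
  Dedekind domain are discrete valuation rings; valuation rings). [AtiyahMacdonald1969]
* J.-P. Serre, *Local Fields*, GTM 67, Ch. I §7 (decomposition group of a prime of the integral closure). [SerreLocalFields1979]

## Design notes

* `ℤ̄_𝔓` is defined by the explicit carrier `{x | ∃ n d, d ∉ 𝔓 ∧ x d = n}` (not through `Localization.AtPrime`), so
  that membership, the Galois action and the residue map `n/d ↦ n̄/d̄` are computed directly; `ℤ̄/𝔓` is a field through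
  the local instance `Ideal.Quotient.field`, as in `PicardLambdaAdicRepLocal`.
* What is NOT here: the identification of `ℤ̄_𝔓` with the abstract localization, completeness, Hensel's lemma.
-/

noncomputable section

open Polynomial
open scoped NumberField IntermediateField Pointwise Classical

namespace Literature.NumberTheory.GaloisRepresentations

open Field

attribute [local instance] Ideal.Quotient.field

set_option synthInstance.maxHeartbeats 160000


variable {K : Type*} [Field K]

/-! ### The local ring `ℤ̄_𝔓` as a subring of `K̄` -/

section Subring

variable (𝔓 : Ideal (absIntegers (𝓞 K) K)) [𝔓.IsPrime]

/-- **The local ring `ℤ̄_𝔓 ⊆ K̄`** of the prime `𝔓` of the ring `ℤ̄ = absIntegers (𝓞 K) K` of all algebraic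
integers of `K̄ = AlgebraicClosure K`: the fractions `n / d` with `n, d ∈ ℤ̄`, `d ∉ 𝔓` (as a subring of `K̄`;
for a number field `K` and `𝔓` maximal it is a valuation ring of `K̄`, `absIntegersValuationSubring`). [folklore] -/
def absIntegersLocalization : Subring (AlgebraicClosure K) where
  carrier := {x | ∃ n d : absIntegers (𝓞 K) K, d ∉ 𝔓 ∧ x * d = n}
  mul_mem' := by
    rintro x y ⟨n, d, hd, hx⟩ ⟨n', d', hd', hy⟩
    refine ⟨n * n', d * d', fun h => ((Ideal.IsPrime.mem_or_mem ‹_› h).elim hd hd'), ?_⟩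
    rw [Subalgebra.coe_mul, Subalgebra.coe_mul, ← hx, ← hy]; ring
  one_mem' := ⟨1, 1, fun h => (Ideal.IsPrime.ne_top ‹_›) ((Ideal.eq_top_iff_one _).2 h), by simp⟩
  add_mem' := by
    rintro x y ⟨n, d, hd, hx⟩ ⟨n', d', hd', hy⟩
    refine ⟨n * d' + n' * d, d * d', fun h => ((Ideal.IsPrime.mem_or_mem ‹_› h).elim hd hd'), ?_⟩
    rw [Subalgebra.coe_add, Subalgebra.coe_mul, Subalgebra.coe_mul, Subalgebra.coe_mul, ← hx, ← hy]; ring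
  zero_mem' := ⟨0, 1, fun h => (Ideal.IsPrime.ne_top ‹_›) ((Ideal.eq_top_iff_one _).2 h), by simp⟩
  neg_mem' := by
    rintro x ⟨n, d, hd, hx⟩
    exact ⟨-n, d, hd, by rw [Subalgebra.coe_neg, ← hx]; ring⟩

/-- Membership in `ℤ̄_𝔓`: `x = n / d` with `d ∉ 𝔓`. [folklore] -/
theorem mem_absIntegersLocalization_iff {x : AlgebraicClosure K} :
    x ∈ absIntegersLocalization 𝔓 ↔ ∃ n d : absIntegers (𝓞 K) K, d ∉ 𝔓 ∧ x * d = n :=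
  Iff.rfl

/-- `1 ∉ 𝔓`. [folklore] -/
theorem one_notMem_of_isPrime : (1 : absIntegers (𝓞 K) K) ∉ 𝔓 := fun h =>
  (Ideal.IsPrime.ne_top ‹_›) ((Ideal.eq_top_iff_one _).2 h)

/-- `ℤ̄ ⊆ ℤ̄_𝔓`. [folklore] -/
theorem coe_mem_absIntegersLocalization (a : absIntegers (𝓞 K) K) :
    (a : AlgebraicClosure K) ∈ absIntegersLocalization 𝔓 :=
  ⟨a, 1, one_notMem_of_isPrime 𝔓, by simp⟩

omit [𝔓.IsPrime] in
/-- A nonzero-mod-`𝔓` element of `ℤ̄` is nonzero in `K̄`. [folklore] -/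
theorem coe_ne_zero_of_notMem {d : absIntegers (𝓞 K) K} (hd : d ∉ 𝔓) : (d : AlgebraicClosure K) ≠ 0 := fun h =>
  hd (by rw [show d = 0 from Subtype.ext h]; exact 𝔓.zero_mem)

/-- `1 / d ∈ ℤ̄_𝔓` for `d ∈ ℤ̄ ∖ 𝔓`. [folklore] -/
theorem inv_coe_mem_absIntegersLocalization {d : absIntegers (𝓞 K) K} (hd : d ∉ 𝔓) :
    (d : AlgebraicClosure K)⁻¹ ∈ absIntegersLocalization 𝔓 :=
  ⟨1, d, hd, by rw [inv_mul_cancel₀ (coe_ne_zero_of_notMem 𝔓 hd), OneMemClass.coe_one]⟩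

omit [𝔓.IsPrime] in
/-- The decomposition group `D_𝔓 = {τ ∈ Γ_K : τ 𝔓 = 𝔓}` maps `ℤ̄ ∖ 𝔓` to itself. [folklore] -/
theorem smul_notMem_of_notMem (τ : MulAction.stabilizer (absoluteGaloisGroup K) 𝔓) {d : absIntegers (𝓞 K) K}
    (hd : d ∉ 𝔓) : (τ : absoluteGaloisGroup K) • d ∉ 𝔓 := fun hmem => by
  have h1 : (τ : absoluteGaloisGroup K)⁻¹ • 𝔓 = 𝔓 := by
    have := MulAction.mem_stabilizer_iff.1 (τ⁻¹).2
    rwa [Subgroup.coe_inv] at this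
  have h2 : d ∈ (τ : absoluteGaloisGroup K)⁻¹ • 𝔓 := by
    rw [Ideal.mem_pointwise_smul_iff_inv_smul_mem, inv_inv]; exact hmem
  rw [h1] at h2
  exact hd h2

/-- The decomposition group preserves `ℤ̄_𝔓`. [folklore] -/
theorem smul_mem_absIntegersLocalization (τ : MulAction.stabilizer (absoluteGaloisGroup K) 𝔓)
    {x : AlgebraicClosure K} (hx : x ∈ absIntegersLocalization 𝔓) :
    (τ : absoluteGaloisGroup K) • x ∈ absIntegersLocalization 𝔓 := by
  obtain ⟨n, d, hd, h⟩ := hx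
  refine ⟨(τ : absoluteGaloisGroup K) • n, (τ : absoluteGaloisGroup K) • d, smul_notMem_of_notMem 𝔓 τ hd, ?_⟩
  rw [integralClosure.coe_smul, integralClosure.coe_smul, ← smul_mul', h]

/-- The decomposition group preserves `ℤ̄_𝔓` (iff form). [folklore] -/
theorem smul_mem_absIntegersLocalization_iff (τ : MulAction.stabilizer (absoluteGaloisGroup K) 𝔓)
    (x : AlgebraicClosure K) :
    (τ : absoluteGaloisGroup K) • x ∈ absIntegersLocalization 𝔓 ↔ x ∈ absIntegersLocalization 𝔓 := by
  refine ⟨fun h => ?_, smul_mem_absIntegersLocalization 𝔓 τ⟩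
  have := smul_mem_absIntegersLocalization 𝔓 τ⁻¹ h
  rwa [Subgroup.coe_inv, inv_smul_smul] at this

end Subring

/-! ### `ℤ̄_𝔓` is a valuation ring of `K̄` -/

section Valuation

variable [NumberField K] (𝔓 : Ideal (absIntegers (𝓞 K) K)) [h𝔓m : 𝔓.IsMaximal]

/-- A maximal ideal of `ℤ̄` is nonzero (`ℤ̄` is integral over `𝓞 K`, which is not a field). [folklore] -/
theorem ne_bot_of_isMaximal_absIntegers : 𝔓 ≠ ⊥ := by
  refine Ring.ne_bot_of_isMaximal_of_not_isField h𝔓m fun hF => ?_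
  have hinj : Function.Injective (algebraMap (𝓞 K) (absIntegers (𝓞 K) K)) := fun a b hab => by
    have h := congrArg (fun z : absIntegers (𝓞 K) K => (z : AlgebraicClosure K)) hab
    change algebraMap (𝓞 K) (AlgebraicClosure K) a = algebraMap (𝓞 K) (AlgebraicClosure K) b at h
    rw [IsScalarTower.algebraMap_apply (𝓞 K) K (AlgebraicClosure K),
      IsScalarTower.algebraMap_apply (𝓞 K) K (AlgebraicClosure K)] at h
    exact NumberField.RingOfIntegers.coe_injective ((algebraMap K (AlgebraicClosure K)).injective h)
  exact NumberField.RingOfIntegers.not_isField K ((Algebra.IsIntegral.isField_iff_isField hinj).2 hF)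

/-- `𝔓 ∩ ℤ ≠ 0`: there is a nonzero natural number in `𝔓` (the absolute norm of `𝔓 ∩ 𝓞 K`). [folklore] -/
theorem exists_natCast_mem_absIntegers_ne_zero :
    ∃ m : ℕ, m ≠ 0 ∧ (m : absIntegers (𝓞 K) K) ∈ 𝔓 := by
  set I : Ideal (𝓞 K) := 𝔓.comap (algebraMap (𝓞 K) (absIntegers (𝓞 K) K)) with hI
  have h : I ≠ ⊥ := fun hbot => ne_bot_of_isMaximal_absIntegers 𝔓 (Ideal.eq_bot_of_comap_eq_bot hbot)
  refine ⟨Ideal.absNorm I, fun h0 => h (Ideal.absNorm_eq_zero_iff.1 h0), ?_⟩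
  have hmem : ((Ideal.absNorm I : ℕ) : 𝓞 K) ∈ I := Ideal.absNorm_mem I
  rw [hI, Ideal.mem_comap, map_natCast] at hmem
  exact hmem

/-- **`ℤ̄_𝔓` is a valuation ring of `K̄`**: every `x ∈ K̄` has `x ∈ ℤ̄_𝔓` or `x⁻¹ ∈ ℤ̄_𝔓`.  Proof: `x` lies in the
number field `M = K(x)`; the integral closure `C` of `𝓞 K` in `M` is a Dedekind domain, `𝔮 = 𝔓 ∩ C` is a nonzero
prime (it meets `𝓞 K` non-trivially), so `C_𝔮` is a discrete valuation ring of `M` and `x ∈ C_𝔮` or `x⁻¹ ∈ C_𝔮`,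
while `C_𝔮 ⊆ ℤ̄_𝔓`. [folklore] -/
theorem mem_absIntegersLocalization_or_inv_mem (x : AlgebraicClosure K) :
    x ∈ absIntegersLocalization 𝔓 ∨ x⁻¹ ∈ absIntegersLocalization 𝔓 := by
  classical
  have hxint : IsIntegral K x := Algebra.IsIntegral.isIntegral x
  haveI : FiniteDimensional K K⟮x⟯ := IntermediateField.adjoin.finiteDimensional hxint
  haveI : NumberField K⟮x⟯ := NumberField.of_module_finite K K⟮x⟯
  -- the map `𝓞 K(x) → ℤ̄`
  have hint : ∀ c : 𝓞 K⟮x⟯, algebraMap K⟮x⟯ (AlgebraicClosure K) (c : K⟮x⟯) ∈ absIntegers (𝓞 K) K := fun c =>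
    ((NumberField.RingOfIntegers.isIntegral_coe c).algebraMap (B := AlgebraicClosure K)).tower_top
  let φ : 𝓞 K⟮x⟯ →+* absIntegers (𝓞 K) K :=
    ((algebraMap K⟮x⟯ (AlgebraicClosure K)).comp (algebraMap (𝓞 K⟮x⟯) K⟮x⟯)).codRestrict (absIntegers (𝓞 K) K)
      hint
  have hφ : ∀ c : 𝓞 K⟮x⟯, (φ c : AlgebraicClosure K) = ((c : K⟮x⟯) : AlgebraicClosure K) := fun c => rfl
  -- the prime `𝔮 = 𝔓 ∩ 𝓞 K(x)` is nonzero
  set 𝔮 : Ideal (𝓞 K⟮x⟯) := 𝔓.comap φ with h𝔮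
  haveI h𝔮p : 𝔮.IsPrime := Ideal.comap_isPrime φ 𝔓
  have h𝔮ne : 𝔮 ≠ ⊥ := by
    obtain ⟨m, hm0, hm⟩ := exists_natCast_mem_absIntegers_ne_zero 𝔓
    intro hbot
    have hmem : (m : 𝓞 K⟮x⟯) ∈ 𝔮 := by
      rw [h𝔮, Ideal.mem_comap, map_natCast]; exact hm
    rw [hbot, Ideal.mem_bot, Nat.cast_eq_zero] at hmem
    exact hm0 hmem
  -- the DVR `(𝓞 K(x))_𝔮` inside `K(x)`
  haveI : IsDiscreteValuationRing (Localization.AtPrime 𝔮) :=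
    IsLocalization.AtPrime.isDiscreteValuationRing_of_dedekind_domain (𝓞 K⟮x⟯) h𝔮ne _
  have hunit : ∀ s : 𝔮.primeCompl, IsUnit (algebraMap (𝓞 K⟮x⟯) K⟮x⟯ s) := fun s =>
    isUnit_iff_ne_zero.2 ((map_ne_zero_iff _ (IsFractionRing.injective (𝓞 K⟮x⟯) K⟮x⟯)).2
      fun h => s.2 (by rw [h]; exact 𝔮.zero_mem))
  letI algDM : Algebra (Localization.AtPrime 𝔮) K⟮x⟯ :=
    (IsLocalization.lift (M := 𝔮.primeCompl) (S := Localization.AtPrime 𝔮) hunit).toAlgebra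
  haveI : IsScalarTower (𝓞 K⟮x⟯) (Localization.AtPrime 𝔮) K⟮x⟯ :=
    IsScalarTower.of_algebraMap_eq fun c =>
      (IsLocalization.lift_eq (M := 𝔮.primeCompl) (S := Localization.AtPrime 𝔮) hunit c).symm
  haveI : IsFractionRing (Localization.AtPrime 𝔮) K⟮x⟯ :=
    IsFractionRing.isFractionRing_of_isDomain_of_isLocalization 𝔮.primeCompl (Localization.AtPrime 𝔮) K⟮x⟯
  -- `x ∈ (𝓞 K(x))_𝔮` or `x⁻¹ ∈ (𝓞 K(x))_𝔮`, and `(𝓞 K(x))_𝔮 ⊆ ℤ̄_𝔓`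
  have key : ∀ y : K⟮x⟯, IsLocalization.IsInteger (Localization.AtPrime 𝔮) y →
      (y : AlgebraicClosure K) ∈ absIntegersLocalization 𝔓 := by
    rintro y ⟨d, hd⟩
    obtain ⟨⟨c, s⟩, hcs⟩ := IsLocalization.mk'_surjective 𝔮.primeCompl d
    have hcs' : IsLocalization.mk' (Localization.AtPrime 𝔮) c s = d := hcs
    have h1 : y * algebraMap (𝓞 K⟮x⟯) K⟮x⟯ s = algebraMap (𝓞 K⟮x⟯) K⟮x⟯ c := by
      rw [← hd, ← hcs', IsScalarTower.algebraMap_apply (𝓞 K⟮x⟯) (Localization.AtPrime 𝔮) K⟮x⟯ (s : 𝓞 K⟮x⟯),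
        IsScalarTower.algebraMap_apply (𝓞 K⟮x⟯) (Localization.AtPrime 𝔮) K⟮x⟯ c, ← map_mul, IsLocalization.mk'_spec]
    refine ⟨φ c, φ s, fun h => s.2 (Ideal.mem_comap.2 h), ?_⟩
    rw [hφ, hφ]
    have h2 := congrArg (fun m : K⟮x⟯ => (m : AlgebraicClosure K)) h1
    simpa using h2
  set x' : K⟮x⟯ := ⟨x, IntermediateField.mem_adjoin_simple_self K x⟩ with hx'
  rcases ValuationRing.isInteger_or_isInteger (Localization.AtPrime 𝔮) x' with h | h
  · exact Or.inl (key x' h)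
  · refine Or.inr ?_
    have := key x'⁻¹ h
    simpa using this

/-- **The valuation ring `ℤ̄_𝔓` of `K̄`** attached to a maximal ideal `𝔓` of `ℤ̄`, `K` a number field
(`absIntegersLocalization` as a Mathlib `ValuationSubring`). [folklore] -/
def absIntegersValuationSubring : ValuationSubring (AlgebraicClosure K) :=
  { absIntegersLocalization 𝔓 with
    mem_or_inv_mem' := mem_absIntegersLocalization_or_inv_mem 𝔓 }

/-- Membership in the valuation ring is membership in `ℤ̄_𝔓`. [folklore] -/
@[simp]
theorem mem_absIntegersValuationSubring_iff {x : AlgebraicClosure K} :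
    x ∈ absIntegersValuationSubring 𝔓 ↔ x ∈ absIntegersLocalization 𝔓 :=
  Iff.rfl

/-- **Scaling a finite family into `ℤ̄_𝔓`**: for finitely many elements of `K̄`, not all zero, one of them, `c`,
is nonzero and divides all the others in `ℤ̄_𝔓` (take `c` of maximal valuation). [folklore] -/
theorem exists_div_mem_absIntegersLocalization {ι : Type*} (s : Finset ι) (c : ι → AlgebraicClosure K)
    (hs : ∃ i ∈ s, c i ≠ 0) :
    ∃ i₀ ∈ s, c i₀ ≠ 0 ∧ ∀ i ∈ s, c i / c i₀ ∈ absIntegersLocalization 𝔓 := by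
  set V := absIntegersValuationSubring 𝔓 with hV
  obtain ⟨j, hj, hj0⟩ := hs
  obtain ⟨i₀, hi₀, hmax⟩ := Finset.exists_max_image s (fun i => V.valuation (c i)) ⟨j, hj⟩
  have hi₀0 : c i₀ ≠ 0 := fun h0 => by
    have h1 := hmax j hj
    rw [h0, Valuation.map_zero, le_zero_iff, Valuation.zero_iff] at h1
    exact hj0 h1
  refine ⟨i₀, hi₀, hi₀0, fun i hi => ?_⟩
  rw [← mem_absIntegersValuationSubring_iff, ← V.valuation_le_one_iff, map_div₀, div_le_one₀]
  · exact hmax i hi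
  · exact (Valuation.pos_iff _).2 hi₀0

end Valuation

/-! ### The residue map `ℤ̄_𝔓 → ℤ̄/𝔓` -/

section Residue

variable (𝔓 : Ideal (absIntegers (𝓞 K) K)) [h𝔓m : 𝔓.IsMaximal]

/-- Two fraction representations of the same element of `ℤ̄_𝔓` have the same reduction `n̄ / d̄`. [folklore] -/
theorem mk_mul_inv_eq_of_eq {x : AlgebraicClosure K} {n d n' d' : absIntegers (𝓞 K) K} (hd : d ∉ 𝔓) (hd' : d' ∉ 𝔓)
    (h : x * d = n) (h' : x * d' = n') :
    Ideal.Quotient.mk 𝔓 n * (Ideal.Quotient.mk 𝔓 d)⁻¹ = Ideal.Quotient.mk 𝔓 n' * (Ideal.Quotient.mk 𝔓 d')⁻¹ := by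
  have hnd : n * d' = n' * d := Subtype.ext (by
    rw [Subalgebra.coe_mul, Subalgebra.coe_mul, ← h, ← h']; ring)
  have hd0 : Ideal.Quotient.mk 𝔓 d ≠ 0 := fun h0 => hd (Ideal.Quotient.eq_zero_iff_mem.1 h0)
  have hd0' : Ideal.Quotient.mk 𝔓 d' ≠ 0 := fun h0 => hd' (Ideal.Quotient.eq_zero_iff_mem.1 h0)
  rw [mul_inv_eq_iff_eq_mul₀ hd0, mul_assoc, mul_comm _ (Ideal.Quotient.mk 𝔓 d), ← mul_assoc,
    eq_comm, mul_inv_eq_iff_eq_mul₀ hd0', ← map_mul, ← map_mul, hnd, mul_comm]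

/-- The reduction `n̄ / d̄` of `x = n / d ∈ ℤ̄_𝔓` computed from a chosen representation (auxiliary; use
`absIntegersResidue`). [folklore] -/
def absIntegersResidueAux (x : absIntegersLocalization 𝔓) : absIntegers (𝓞 K) K ⧸ 𝔓 :=
  Ideal.Quotient.mk 𝔓 x.2.choose * (Ideal.Quotient.mk 𝔓 x.2.choose_spec.choose)⁻¹

/-- `absIntegersResidueAux` does not depend on the representation. [folklore] -/
theorem absIntegersResidueAux_eq {x : absIntegersLocalization 𝔓} {n d : absIntegers (𝓞 K) K} (hd : d ∉ 𝔓)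
    (h : (x : AlgebraicClosure K) * d = n) :
    absIntegersResidueAux 𝔓 x = Ideal.Quotient.mk 𝔓 n * (Ideal.Quotient.mk 𝔓 d)⁻¹ := by
  obtain ⟨hdx, hx⟩ := x.2.choose_spec.choose_spec
  exact mk_mul_inv_eq_of_eq 𝔓 hdx hd hx h

/-- **The residue map `ℤ̄_𝔓 → ℤ̄/𝔓`**, `n / d ↦ n̄ / d̄` (`𝔓` maximal, so `ℤ̄/𝔓` is a field and `d̄ ≠ 0`).
[folklore] -/
def absIntegersResidue : absIntegersLocalization 𝔓 →+* absIntegers (𝓞 K) K ⧸ 𝔓 where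
  toFun := absIntegersResidueAux 𝔓
  map_one' := by
    rw [absIntegersResidueAux_eq 𝔓 (n := 1) (d := 1) (one_notMem_of_isPrime 𝔓) (by simp), map_one, inv_one, mul_one]
  map_mul' x y := by
    obtain ⟨n, d, hd, hx⟩ := x.2
    obtain ⟨n', d', hd', hy⟩ := y.2
    have hd0 : Ideal.Quotient.mk 𝔓 d ≠ 0 := fun h0 => hd (Ideal.Quotient.eq_zero_iff_mem.1 h0)
    have hd0' : Ideal.Quotient.mk 𝔓 d' ≠ 0 := fun h0 => hd' (Ideal.Quotient.eq_zero_iff_mem.1 h0)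
    rw [absIntegersResidueAux_eq 𝔓 hd hx, absIntegersResidueAux_eq 𝔓 hd' hy,
      absIntegersResidueAux_eq 𝔓 (n := n * n') (d := d * d')
        (fun h => ((Ideal.IsPrime.mem_or_mem inferInstance h).elim hd hd'))
        (by rw [Subring.coe_mul, Subalgebra.coe_mul, Subalgebra.coe_mul, ← hx, ← hy]; ring),
      map_mul, map_mul, mul_inv]
    ring
  map_zero' := by
    rw [absIntegersResidueAux_eq 𝔓 (n := 0) (d := 1) (one_notMem_of_isPrime 𝔓) (by simp), map_zero, zero_mul]
  map_add' x y := by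
    obtain ⟨n, d, hd, hx⟩ := x.2
    obtain ⟨n', d', hd', hy⟩ := y.2
    have hd0 : Ideal.Quotient.mk 𝔓 d ≠ 0 := fun h0 => hd (Ideal.Quotient.eq_zero_iff_mem.1 h0)
    have hd0' : Ideal.Quotient.mk 𝔓 d' ≠ 0 := fun h0 => hd' (Ideal.Quotient.eq_zero_iff_mem.1 h0)
    rw [absIntegersResidueAux_eq 𝔓 hd hx, absIntegersResidueAux_eq 𝔓 hd' hy,
      absIntegersResidueAux_eq 𝔓 (n := n * d' + n' * d) (d := d * d')
        (fun h => ((Ideal.IsPrime.mem_or_mem inferInstance h).elim hd hd'))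
        (by rw [Subring.coe_add, Subalgebra.coe_add, Subalgebra.coe_mul, Subalgebra.coe_mul, Subalgebra.coe_mul,
              ← hx, ← hy]; ring),
      map_add, map_mul, map_mul, map_mul, mul_inv]
    field_simp

/-- **The residue of `n / d` is `n̄ / d̄`.** [folklore] -/
theorem absIntegersResidue_eq {x : absIntegersLocalization 𝔓} {n d : absIntegers (𝓞 K) K} (hd : d ∉ 𝔓)
    (h : (x : AlgebraicClosure K) * d = n) :
    absIntegersResidue 𝔓 x = Ideal.Quotient.mk 𝔓 n * (Ideal.Quotient.mk 𝔓 d)⁻¹ :=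
  absIntegersResidueAux_eq 𝔓 hd h

/-- The residue of an algebraic integer is its class mod `𝔓`. [folklore] -/
theorem absIntegersResidue_coe (a : absIntegers (𝓞 K) K) :
    absIntegersResidue 𝔓 ⟨a, coe_mem_absIntegersLocalization 𝔓 a⟩ = Ideal.Quotient.mk 𝔓 a := by
  rw [absIntegersResidue_eq 𝔓 (n := a) (d := 1) (one_notMem_of_isPrime 𝔓) (by simp), map_one, inv_one, mul_one]

/-- The residue map is surjective. [folklore] -/
theorem absIntegersResidue_surjective : Function.Surjective (absIntegersResidue 𝔓) := by
  intro y
  obtain ⟨a, rfl⟩ := Ideal.Quotient.mk_surjective y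
  exact ⟨⟨a, coe_mem_absIntegersLocalization 𝔓 a⟩, absIntegersResidue_coe 𝔓 a⟩

/-- **Units of `ℤ̄_𝔓` are detected by the residue**: a nonzero `x ∈ ℤ̄_𝔓` has `x⁻¹ ∈ ℤ̄_𝔓` iff `x̄ ≠ 0`. [folklore] -/
theorem inv_mem_absIntegersLocalization_iff (x : absIntegersLocalization 𝔓) (hx0 : (x : AlgebraicClosure K) ≠ 0) :
    (x : AlgebraicClosure K)⁻¹ ∈ absIntegersLocalization 𝔓 ↔ absIntegersResidue 𝔓 x ≠ 0 := by
  obtain ⟨n, d, hd, h⟩ := x.2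
  have hd0 := coe_ne_zero_of_notMem 𝔓 hd
  have hmk : ∀ a : absIntegers (𝓞 K) K, Ideal.Quotient.mk 𝔓 a ≠ 0 ↔ a ∉ 𝔓 := fun a => by
    rw [Ne, Ideal.Quotient.eq_zero_iff_mem]
  rw [absIntegersResidue_eq 𝔓 hd h, mul_ne_zero_iff, hmk, and_iff_left (inv_ne_zero ((hmk d).2 hd))]
  constructor
  · rintro ⟨n', d', hd', h'⟩ hn
    have hdd : d * d' = n * n' := Subtype.ext (by
      rw [Subalgebra.coe_mul, Subalgebra.coe_mul, ← h, ← h']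
      field_simp)
    have hmem : d * d' ∈ 𝔓 := hdd ▸ 𝔓.mul_mem_right _ hn
    exact ((Ideal.IsPrime.mem_or_mem inferInstance hmem).elim hd hd')
  · intro hn
    refine ⟨d, n, hn, ?_⟩
    rw [← h, inv_mul_cancel_left₀ hx0]

/-- Variant: for nonzero `x ∈ ℤ̄_𝔓`, `x̄ = 0 ↔ x⁻¹ ∉ ℤ̄_𝔓`. [folklore] -/
theorem absIntegersResidue_eq_zero_iff (x : absIntegersLocalization 𝔓) (hx0 : (x : AlgebraicClosure K) ≠ 0) :
    absIntegersResidue 𝔓 x = 0 ↔ (x : AlgebraicClosure K)⁻¹ ∉ absIntegersLocalization 𝔓 := by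
  rw [inv_mem_absIntegersLocalization_iff 𝔓 x hx0, not_not]

/-- **A product `x * y⁻¹` with `x, y ∈ ℤ̄_𝔓`, `ȳ ≠ 0` lies in `ℤ̄_𝔓` and reduces to `x̄ / ȳ`.** [folklore] -/
theorem absIntegersResidue_mul_inv {x y : absIntegersLocalization 𝔓} (hy : absIntegersResidue 𝔓 y ≠ 0)
    (hmem : (x : AlgebraicClosure K) * (y : AlgebraicClosure K)⁻¹ ∈ absIntegersLocalization 𝔓) :
    absIntegersResidue 𝔓 ⟨(x : AlgebraicClosure K) * (y : AlgebraicClosure K)⁻¹, hmem⟩ =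
      absIntegersResidue 𝔓 x * (absIntegersResidue 𝔓 y)⁻¹ := by
  have hy0 : (y : AlgebraicClosure K) ≠ 0 := fun h0 => hy (by
    rw [show y = 0 from Subtype.ext h0, map_zero])
  have hyinv : (y : AlgebraicClosure K)⁻¹ ∈ absIntegersLocalization 𝔓 :=
    (inv_mem_absIntegersLocalization_iff 𝔓 y hy0).2 hy
  have h1 : (⟨(x : AlgebraicClosure K) * (y : AlgebraicClosure K)⁻¹, hmem⟩ : absIntegersLocalization 𝔓) =
      x * ⟨(y : AlgebraicClosure K)⁻¹, hyinv⟩ := Subtype.ext rfl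
  have h2 : y * ⟨(y : AlgebraicClosure K)⁻¹, hyinv⟩ = 1 := Subtype.ext (mul_inv_cancel₀ hy0)
  rw [h1, map_mul, eq_mul_inv_iff_mul_eq₀ hy, mul_assoc, ← map_mul, mul_comm _ y, h2, map_one, mul_one]

variable (𝔭 : Ideal (𝓞 K)) [𝔓.LiesOver 𝔭]

/-- **The residue map is `D_𝔓`-equivariant**: `(τ x)‾ = τ̄ (x̄)` with `τ̄ = Ideal.Quotient.stabilizerHom τ` the induced
automorphism of `ℤ̄/𝔓`. [folklore] -/
theorem absIntegersResidue_smul (τ : MulAction.stabilizer (absoluteGaloisGroup K) 𝔓)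
    (x : absIntegersLocalization 𝔓) :
    absIntegersResidue 𝔓 ⟨(τ : absoluteGaloisGroup K) • (x : AlgebraicClosure K),
        smul_mem_absIntegersLocalization 𝔓 τ x.2⟩ =
      Ideal.Quotient.stabilizerHom 𝔓 𝔭 (absoluteGaloisGroup K) τ (absIntegersResidue 𝔓 x) := by
  obtain ⟨n, d, hd, h⟩ := x.2
  rw [absIntegersResidue_eq 𝔓 hd h,
    absIntegersResidue_eq 𝔓 (n := (τ : absoluteGaloisGroup K) • n) (smul_notMem_of_notMem 𝔓 τ hd)
      (by change ((τ : absoluteGaloisGroup K) • (x : AlgebraicClosure K)) * _ = _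
          rw [integralClosure.coe_smul, integralClosure.coe_smul, ← smul_mul', h]),
    map_mul, map_inv₀, Ideal.Quotient.stabilizerHom_apply, Ideal.Quotient.stabilizerHom_apply]
  rfl

end Residue


/-! ### The residue map on `K̄` and the roots of a reduction -/

section Roots

variable (𝔓 : Ideal (absIntegers (𝓞 K) K)) [h𝔓m : 𝔓.IsMaximal]

/-- **The residue map extended to `K̄`**: `ā` for `a ∈ ℤ̄_𝔓`, junk value `0` off `ℤ̄_𝔓`. [folklore] -/
def absIntegersResidue' (a : AlgebraicClosure K) : absIntegers (𝓞 K) K ⧸ 𝔓 :=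
  if h : a ∈ absIntegersLocalization 𝔓 then absIntegersResidue 𝔓 ⟨a, h⟩ else 0

/-- On `ℤ̄_𝔓` the extended residue map is the residue map. [folklore] -/
theorem absIntegersResidue'_of_mem {a : AlgebraicClosure K} (h : a ∈ absIntegersLocalization 𝔓) :
    absIntegersResidue' 𝔓 a = absIntegersResidue 𝔓 ⟨a, h⟩ := by
  rw [absIntegersResidue', dif_pos h]

/-- On `ℤ̄_𝔓` the extended residue map is the residue map (subtype form). [folklore] -/
@[simp]
theorem absIntegersResidue'_coe (x : absIntegersLocalization 𝔓) :
    absIntegersResidue' 𝔓 (x : AlgebraicClosure K) = absIntegersResidue 𝔓 x := by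
  rw [absIntegersResidue'_of_mem 𝔓 x.2]

variable [NumberField K]

/-- A non-integral element is nonzero, its inverse is integral and reduces to `0`. [folklore] -/
theorem inv_mem_and_residue_eq_zero_of_not_mem {α : AlgebraicClosure K} (hα : α ∉ absIntegersLocalization 𝔓) :
    α ≠ 0 ∧ ∃ h : α⁻¹ ∈ absIntegersLocalization 𝔓, absIntegersResidue 𝔓 ⟨α⁻¹, h⟩ = 0 := by
  have hα0 : α ≠ 0 := by rintro rfl; exact hα (Subring.zero_mem _)
  have hinv : α⁻¹ ∈ absIntegersLocalization 𝔓 := (mem_absIntegersLocalization_or_inv_mem 𝔓 α).resolve_left hα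
  refine ⟨hα0, hinv, ?_⟩
  rw [absIntegersResidue_eq_zero_iff 𝔓 ⟨α⁻¹, hinv⟩ (inv_ne_zero hα0)]
  change (α⁻¹)⁻¹ ∉ _
  rwa [inv_inv]

/-- The roots of `∏ (1 - αᵢ⁻¹ X)` reduce away: `(1 - C α⁻¹ X)` reduces to `1` when `α ∉ ℤ̄_𝔓`. [folklore] -/
theorem map_residue_one_sub_C_inv_mul_X {α : AlgebraicClosure K} (hα : α ∉ absIntegersLocalization 𝔓) :
    ((1 : (absIntegersLocalization 𝔓)[X]) -
        C (⟨α⁻¹, (inv_mem_and_residue_eq_zero_of_not_mem 𝔓 hα).2.choose⟩ : absIntegersLocalization 𝔓) * X).map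
      (absIntegersResidue 𝔓) = 1 := by
  rw [Polynomial.map_sub, Polynomial.map_one, Polynomial.map_mul, Polynomial.map_X, Polynomial.map_C,
    (inv_mem_and_residue_eq_zero_of_not_mem 𝔓 hα).2.choose_spec, map_zero, zero_mul, sub_zero]

/-- **Roots of a reduction** (Gauss / Hensel counting, the "Dedekind dictionary" for `ℤ̄_𝔓`).  Let `R ∈ ℤ̄_𝔓[X]` with
`R mod 𝔓 ≠ 0`.  Then the roots of `R mod 𝔓` in `κ(𝔓) = ℤ̄/𝔓`, with multiplicity, are exactly the reductions of the
`𝔓`-integral roots of `R` in `K̄`: writing `R = c ∏_{αᵢ ∈ ℤ̄_𝔓} (X - αᵢ) ∏_{αⱼ ∉ ℤ̄_𝔓} (1 - αⱼ⁻¹ X)` (valuation ring!),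
`c` is a `𝔓`-unit and `R mod 𝔓 = c̄ ∏ (X - ᾱᵢ)`. [folklore] -/
theorem roots_map_absIntegersResidue (R : (absIntegersLocalization 𝔓)[X]) (hR : R.map (absIntegersResidue 𝔓) ≠ 0) :
    (R.map (absIntegersResidue 𝔓)).roots =
      ((R.map (absIntegersLocalization 𝔓).subtype).roots.filter (· ∈ absIntegersLocalization 𝔓)).map
        (absIntegersResidue' 𝔓) := by
  set ι : absIntegersLocalization 𝔓 →+* AlgebraicClosure K := (absIntegersLocalization 𝔓).subtype with hι
  set res := absIntegersResidue 𝔓 with hres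
  set RK := R.map ι with hRK
  have hιinj : Function.Injective ι := Subtype.coe_injective
  have hR0 : R ≠ 0 := by rintro rfl; exact hR (Polynomial.map_zero _)
  have hRK0 : RK ≠ 0 := (Polynomial.map_ne_zero_iff hιinj).2 hR0
  set M := RK.roots with hM
  set I := M.filter (· ∈ absIntegersLocalization 𝔓) with hI
  set N := M.filter (· ∉ absIntegersLocalization 𝔓) with hN
  have hMN : I + N = M := Multiset.filter_add_not _ M
  have hmemI : ∀ α ∈ I, α ∈ absIntegersLocalization 𝔓 := fun α hα => (Multiset.mem_filter.1 hα).2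
  have hmemN : ∀ α ∈ N, α ∉ absIntegersLocalization 𝔓 := fun α hα => (Multiset.mem_filter.1 hα).2
  -- the integral avatars of the two products
  set PI : (absIntegersLocalization 𝔓)[X] :=
    (I.attach.map fun α => X - C (⟨α.1, hmemI α.1 α.2⟩ : absIntegersLocalization 𝔓)).prod with hPI
  set PN : (absIntegersLocalization 𝔓)[X] := (N.attach.map fun α => (1 : (absIntegersLocalization 𝔓)[X]) -
    C (⟨α.1⁻¹, (inv_mem_and_residue_eq_zero_of_not_mem 𝔓 (hmemN α.1 α.2)).2.choose⟩ : absIntegersLocalization 𝔓) * X).prod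
    with hPN
  have hPIι : PI.map ι = (I.map fun α => X - C α).prod := by
    rw [hPI, Polynomial.map_multiset_prod, Multiset.map_map]
    conv_rhs => rw [← Multiset.attach_map_val' I (fun α => X - C α)]
    refine congrArg _ (Multiset.map_congr rfl fun α _ => ?_)
    simp [hι]
  have hPNι : PN.map ι = (N.map fun α => (1 : (AlgebraicClosure K)[X]) - C α⁻¹ * X).prod := by
    rw [hPN, Polynomial.map_multiset_prod, Multiset.map_map]
    conv_rhs => rw [← Multiset.attach_map_val' N (fun α => (1 : (AlgebraicClosure K)[X]) - C α⁻¹ * X)]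
    refine congrArg _ (Multiset.map_congr rfl fun α _ => ?_)
    simp [hι]
  have hPIres : PI.map res = ((I.map (absIntegersResidue' 𝔓)).map fun a => X - C a).prod := by
    rw [hPI, Polynomial.map_multiset_prod, Multiset.map_map, Multiset.map_map]
    conv_rhs => rw [← Multiset.attach_map_val' I ((fun a => X - C a) ∘ absIntegersResidue' 𝔓)]
    refine congrArg _ (Multiset.map_congr rfl fun α _ => ?_)
    simp only [Function.comp_apply, Polynomial.map_sub, Polynomial.map_X, Polynomial.map_C]
    rw [absIntegersResidue'_of_mem 𝔓 (hmemI α.1 α.2)]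
  have hPNres : PN.map res = 1 := by
    rw [hPN, Polynomial.map_multiset_prod, Multiset.map_map]
    refine Multiset.prod_eq_one fun q hq => ?_
    obtain ⟨α, -, rfl⟩ := Multiset.mem_map.1 hq
    exact map_residue_one_sub_C_inv_mul_X 𝔓 (hmemN α.1 α.2)
  -- `RK = c' · PI · PN` over `K̄`
  set cN : AlgebraicClosure K := (N.map fun α => -α).prod with hcN
  have hNprod : (N.map fun α => X - C α).prod =
      C cN * (N.map fun α => (1 : (AlgebraicClosure K)[X]) - C α⁻¹ * X).prod := by
    have h1 : (N.map fun α => X - C α) = N.map (fun α => C (-α) * ((1 : (AlgebraicClosure K)[X]) - C α⁻¹ * X)) :=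
      Multiset.map_congr rfl fun α hα => by
        have hα0 : α ≠ 0 := (inv_mem_and_residue_eq_zero_of_not_mem 𝔓 (hmemN α hα)).1
        have h2 : C (-α) * ((1 : (AlgebraicClosure K)[X]) - C α⁻¹ * X) = X - C α := by
          rw [mul_sub, mul_one, ← mul_assoc, ← map_mul, neg_mul, mul_inv_cancel₀ hα0, map_neg, map_neg, map_one]
          ring
        exact h2.symm
    rw [h1, Multiset.prod_map_mul, hcN, map_multiset_prod C, Multiset.map_map]
    rfl
  have hsplit : C RK.leadingCoeff * (M.map fun α => X - C α).prod = RK :=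
    C_leadingCoeff_mul_prod_multiset_X_sub_C IsAlgClosed.card_roots_eq_natDegree
  set c' : AlgebraicClosure K := RK.leadingCoeff * cN with hc'
  set P : (absIntegersLocalization 𝔓)[X] := PI * PN with hP
  have hE1 : RK = C c' * P.map ι := by
    conv_lhs => rw [← hsplit, ← hMN, Multiset.map_add, Multiset.prod_add, hNprod]
    rw [hP, Polynomial.map_mul, hPIι, hPNι, hc', map_mul]
    ring
  -- the reduction of `P` is monic of degree `#I`
  have hPres : P.map res = ((I.map (absIntegersResidue' 𝔓)).map fun a => X - C a).prod := by
    rw [hP, Polynomial.map_mul, hPIres, hPNres, mul_one]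
  have hPres_monic : (P.map res).Monic := by
    rw [hPres]
    exact monic_multiset_prod_of_monic _ _ fun a _ => monic_X_sub_C a
  have hPres_deg : (P.map res).natDegree = Multiset.card I := by
    rw [hPres, natDegree_multiset_prod_X_sub_C_eq_card, Multiset.card_map]
  set d : ℕ := Multiset.card I with hd
  have hu : res (P.coeff d) = 1 := by
    rw [← Polynomial.coeff_map, ← hPres_deg]
    exact hPres_monic.coeff_natDegree
  have hu0 : ((P.coeff d : absIntegersLocalization 𝔓) : AlgebraicClosure K) ≠ 0 := fun h0 => by
    have : P.coeff d = 0 := Subtype.ext h0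
    rw [this, map_zero] at hu
    exact zero_ne_one hu
  have huinv : ((P.coeff d : absIntegersLocalization 𝔓) : AlgebraicClosure K)⁻¹ ∈ absIntegersLocalization 𝔓 :=
    (inv_mem_absIntegersLocalization_iff 𝔓 (P.coeff d) hu0).2 (by rw [← hres, hu]; exact one_ne_zero)
  -- the constant `c'` is `𝔓`-integral: `c' = R_d / P_d`
  set c'' : absIntegersLocalization 𝔓 :=
    R.coeff d * ⟨((P.coeff d : absIntegersLocalization 𝔓) : AlgebraicClosure K)⁻¹, huinv⟩ with hc''
  have hE2 : c' = ι c'' := by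
    have h1 : RK.coeff d = c' * ι (P.coeff d) := by
      rw [hE1, coeff_C_mul, coeff_map]
    rw [hRK, coeff_map] at h1
    rw [hc'', map_mul, h1, mul_assoc]
    change c' = c' * (((P.coeff d : absIntegersLocalization 𝔓) : AlgebraicClosure K) *
      ((P.coeff d : absIntegersLocalization 𝔓) : AlgebraicClosure K)⁻¹)
    rw [mul_inv_cancel₀ hu0, mul_one]
  have hE3 : R = C c'' * P := Polynomial.map_injective ι hιinj (by
    rw [Polynomial.map_mul, Polynomial.map_C, ← hE2, ← hRK, hE1])
  have hRres : R.map res = C (res c'') * P.map res := by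
    conv_lhs => rw [hE3]
    rw [Polynomial.map_mul, Polynomial.map_C]
  have hc0 : res c'' ≠ 0 := fun h0 => hR (by rw [hRres, h0, map_zero, zero_mul])
  rw [hRres, roots_C_mul _ hc0, hPres, roots_multiset_prod_X_sub_C]

/-- **Counting roots of the reduction**: the multiplicity of `ā₀ ∈ κ(𝔓)` as a root of `R mod 𝔓` is the total
multiplicity of the `𝔓`-integral roots of `R` in `K̄` reducing to `ā₀`. [folklore] -/
theorem rootMultiplicity_map_absIntegersResidue (R : (absIntegersLocalization 𝔓)[X])
    (hR : R.map (absIntegersResidue 𝔓) ≠ 0) (ā₀ : absIntegers (𝓞 K) K ⧸ 𝔓) :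
    (R.map (absIntegersResidue 𝔓)).rootMultiplicity ā₀ =
      ∑ a ∈ ((R.map (absIntegersLocalization 𝔓).subtype).roots.toFinset.filter
          fun a => a ∈ absIntegersLocalization 𝔓 ∧ absIntegersResidue' 𝔓 a = ā₀),
        (R.map (absIntegersLocalization 𝔓).subtype).rootMultiplicity a := by
  rw [← count_roots, roots_map_absIntegersResidue 𝔓 R hR, Multiset.count_map, Multiset.filter_filter]
  set M := (R.map (absIntegersLocalization 𝔓).subtype).roots with hM
  have hfs : (M.filter fun a => ā₀ = absIntegersResidue' 𝔓 a ∧ a ∈ absIntegersLocalization 𝔓).toFinset =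
      M.toFinset.filter fun a => a ∈ absIntegersLocalization 𝔓 ∧ absIntegersResidue' 𝔓 a = ā₀ := by
    ext a
    simp only [Multiset.mem_toFinset, Multiset.mem_filter, Finset.mem_filter]
    constructor
    · rintro ⟨hm, h1, h2⟩; exact ⟨hm, h2, h1.symm⟩
    · rintro ⟨hm, h1, h2⟩; exact ⟨hm, h2.symm, h1⟩
  rw [← Multiset.toFinset_sum_count_eq, hfs]
  refine Finset.sum_congr rfl fun a ha => ?_
  obtain ⟨-, h1, h2⟩ := Finset.mem_filter.1 ha
  rw [Multiset.count_filter, if_pos ⟨h2.symm, h1⟩, hM, count_roots]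

end Roots

end Literature.NumberTheory.GaloisRepresentations
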